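import Literature.Geometry.Lorentzian.HorizonPenetratingTeukolsky
import Literature.Geometry.Lorentzian.KerrSchildHomogeneity
import HarnessLib

/-!
# Sourced Teukolsky slab pairs pull back along the Kerr–Schild dilation

Stub `D2` (`stub_slabPair_dilate`) of the line `bounded-kappa-closing-box` for the crux
`BulkKerrCaptureC2` (route `PhaseMixingCapture`). The Kerr family is homothetic: in Kerr–Schild
Cartesian coordinates `g_{λM,λa}(λx) = g_{M,a}(x)`, and the chart domains are dilation covariant,
`λx ∈ Kerr.region (λa) (λr₀) ↔ x ∈ Kerr.region a r₀` (`Kerr.mem_region_dilate_iff`). We prove: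
given

* `D1` (dilation covariance of the Teukolsky operator, hypothesis `hOp`):
  `𝔗_{M,a,r₀}[α ∘ D_λ](x) = 𝔗_{λM,λa,λr₀}[α](λx)` whenever the extension by zero of `α` is `C²`
  at `λx`, and
* `D0` (hypothesis `hSmooth`): the field `α` of a sourced slab pair is `C^∞` (its extension by
  zero) at every point of the open slab neighbourhood off the axis and off `{Δ = 0}`,

a sourced spin-`s` Teukolsky pair `(α, F)` on the slab `τ₀ ≤ t* ≤ τ₁` of the dilated chart
`{r > λr₀}` of Kerr(`λM, λa`) (`Kerr.IsTeukolskyPairOnSlab`) pulls back under `D_λ : y ↦ λy` to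
the sourced pair `(α ∘ D_λ, F ∘ D_λ)` on the slab `τ₀/λ ≤ t* ≤ τ₁/λ` of the chart `{r > r₀}` of
Kerr(`M, a`).

Proof. (i) Pointwise dilation identities (valid at every point, junk values included):
`r(λa; λy) = λ r(a; y)` (`Kerr.radius_smul`), `cos θ`, `sin θ` are invariant, so the frame vector
scales, `m(λa; λy) = λ m(a; y)`, hence `m_s(λa; λy) = λ m_s(a; y)`; and
`Δ(λM, λa; λr) = λ² Δ(M, a; r)`, so the horizon-regular rescaling factor
`Δ^s (r² + a²)^{-max(s,0)}` scales by `(λ²)^s (λ²)^{-max(s,0)}`. Consequently the rescaled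
tensorised field of `α` at `λy` is `K` times that of `α ∘ D_λ` at `y`, with the non-zero constant
`K = (λ²)^s (λ²)^{-max(s,0)} λ²`. (ii) If `T`, `S` are the smooth witnesses of the pair on
`{τ₀ − θ < t* < τ₁ + θ}`, then `K⁻¹ • (T ∘ D_λ)`, `K⁻¹ • (S ∘ D_λ)` are smooth on
`{τ₀/λ − θ' < t* < τ₁/λ + θ'}` for `θ' ≤ θ/λ` (`D_λ` is the restriction of a linear map and sends
this set into the former) and agree there, off the axis and off `{Δ = 0}` (two dilation invariant
conditions), with the rescaled tensorised fields of `α ∘ D_λ`, `F ∘ D_λ`. (iii) The equation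
`𝔗[α ∘ D_λ] = F ∘ D_λ` is `D1` composed with the equation of the pair at `λy`; the `C²` premise of
`D1` is supplied by `D0` applied to the ORIGINAL pair (whence `θ' = min θ θ₀ / λ`, `θ₀` the
half-width provided by `D0`).

## References

* M. Dafermos, G. Holzegel, I. Rodnianski, M. Taylor, arXiv:2212.14093, §1.1 (1.3)
  (key `DafermosHolzegelRodnianskiTaylor2022`).
* R. P. Kerr, A. Schild, 1965, §2 (key `KerrSchild1965`).
* M. Visser, arXiv:0706.0622, (32)–(36) (key `arXiv07060622`).
-/

-- the doubled `FinalStateConjecture.FinalStateConjecture` path component trips dupNamespace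
set_option linter.dupNamespace false

noncomputable section

namespace Summit.FinalStateConjecture.FinalStateConjecture.Theorems.BulkKerrCaptureC2.SlabPairDilate

open Literature.Geometry.Lorentzian
open scoped Manifold ContDiff Topology

variable {lam : ℝ}

/-! ### Dilation of the Boyer–Lindquist quantities of the Kerr–Schild chart -/

/-- Components of a dilated point: `(λx)_i = λ x_i`. [folklore] -/
private theorem smul_coord (lam : ℝ) (x : E4) (i : Fin 4) : (lam • x) i = lam * x i := by
  simp

/-- `Δ(λM, λa; λr) = λ² Δ(M, a; r)`. [cite: BoyerLindquist1967] -/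
private theorem delta_dilate (lam M a r : ℝ) :
    Kerr.delta (lam * M) (lam * a) (lam * r) = lam ^ 2 * Kerr.delta M a r := by
  unfold Kerr.delta
  ring

/-- `Δ(λM, λa; r(λa; λy)) = λ² Δ(M, a; r(a; y))` (`λ > 0`). [cite: BoyerLindquist1967] -/
private theorem delta_radius_dilate (hlam : 0 < lam) (M a : ℝ) (y : E4) :
    Kerr.delta (lam * M) (lam * a) (Kerr.radius (lam * a) (lam • y)) =
      lam ^ 2 * Kerr.delta M a (Kerr.radius a y) := by
  rw [Kerr.radius_smul hlam, delta_dilate]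

/-- `cos θ` is dilation invariant: `cos θ (λa; λx) = cos θ (a; x)` (`λ > 0`).
[cite: arXiv07060622, (36)] -/
private theorem cosTheta_dilate (hlam : 0 < lam) (a : ℝ) (x : E4) :
    Kerr.cosTheta (lam * a) (lam • x) = Kerr.cosTheta a x := by
  unfold Kerr.cosTheta
  rw [Kerr.radius_smul hlam, smul_coord]
  exact mul_div_mul_left _ _ hlam.ne'

/-- The cylindrical radius scales: `ϖ(λx) = λ ϖ(x)` (`λ > 0`). [cite: arXiv07060622, (36)] -/
private theorem axialRadius_dilate (hlam : 0 < lam) (x : E4) :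
    Kerr.axialRadius (lam • x) = lam * Kerr.axialRadius x := by
  unfold Kerr.axialRadius
  rw [smul_coord, smul_coord,
    show (lam * x 1) ^ 2 + (lam * x 2) ^ 2 = lam ^ 2 * (x 1 ^ 2 + x 2 ^ 2) by ring,
    Real.sqrt_mul (sq_nonneg lam), Real.sqrt_sq hlam.le]

/-- `sin θ` is dilation invariant: `sin θ (λa; λx) = sin θ (a; x)` (`λ > 0`).
[cite: arXiv07060622, (36)] -/
private theorem sinTheta_dilate (hlam : 0 < lam) (a : ℝ) (x : E4) :
    Kerr.sinTheta (lam * a) (lam • x) = Kerr.sinTheta a x := by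
  unfold Kerr.sinTheta
  rw [axialRadius_dilate hlam, Kerr.radius_smul hlam,
    show (lam * Kerr.radius a x) ^ 2 + (lam * a) ^ 2 = lam ^ 2 * (Kerr.radius a x ^ 2 + a ^ 2)
      by ring,
    Real.sqrt_mul (sq_nonneg lam), Real.sqrt_sq hlam.le]
  exact mul_div_mul_left _ _ hlam.ne'

/-- The axis `{x₁ = x₂ = 0}` is dilation invariant (`λ ≠ 0`). [cite: ONeill1995, Ch. 2  §2.1] -/
private theorem smul_mem_axis_iff (hlam : lam ≠ 0) (y : E4) :
    lam • y ∈ Kerr.axis ↔ y ∈ Kerr.axis := by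
  simp [Kerr.axis, hlam]

/-! ### Dilation of the frame, of the rescaling and of the tensorisation -/

/-- **The frame vector scales by `λ`**: `m(λa; λx) = λ m(a; x)` componentwise (`λ > 0`; the
components are `cot θ xᵢ`, `xᵢ / sin θ`, `−r sin θ` with `cos θ`, `sin θ` invariant; junk
values on the axis included, both sides being `0` there). [folklore] -/
private theorem frameM_dilate_apply (hlam : 0 < lam) (a : ℝ) (x : E4) (μ : Fin 4) :
    Kerr.frameM (lam * a) (lam • x) μ = (lam : ℂ) * Kerr.frameM a x μ := by
  have hc := cosTheta_dilate hlam a x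
  have hs := sinTheta_dilate hlam a x
  have hr := Kerr.radius_smul hlam a x
  fin_cases μ
  · simp [Kerr.frameM]
  · simp [Kerr.frameM, hc, hs]
    ring
  · simp [Kerr.frameM, hc, hs]
    ring
  · simp [Kerr.frameM, hs, hr]
    ring

/-- **The spin frame scales by `λ`**: `m_s(λa; λx) = λ m_s(a; x)` componentwise (`λ > 0` is
real, so `m̄` scales the same way). [folklore] -/
private theorem spinFrame_dilate (hlam : 0 < lam) (a : ℝ) (s : ℤ) (x : E4) (μ : Fin 4) :
    Kerr.spinFrame (lam * a) s (lam • x) μ = (lam : ℂ) * Kerr.spinFrame a s x μ := by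
  unfold Kerr.spinFrame
  split_ifs
  · rw [Pi.star_apply, Pi.star_apply, frameM_dilate_apply hlam, star_mul']
    congr 1
    exact Complex.conj_ofReal lam
  · exact frameM_dilate_apply hlam a x μ

/-- **The horizon-regular rescaling factor scales**:
`Δ(λM,λa; r(λa;λy))^s (r(λa;λy)² + (λa)²)^{-max(s,0)}`
`  = (λ²)^s (λ²)^{-max(s,0)} · Δ^s (r² + a²)^{-max(s,0)}`
(`λ > 0`; an identity of junk-extended integer powers, valid also where `Δ = 0`). [folklore] -/
private theorem rescaleFactor_dilate (hlam : 0 < lam) (M a : ℝ) (s : ℤ) (x : E4) :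
    Kerr.delta (lam * M) (lam * a) (Kerr.radius (lam * a) (lam • x)) ^ s *
        (Kerr.radius (lam * a) (lam • x) ^ 2 + (lam * a) ^ 2) ^ (-max s 0) =
      (lam ^ 2) ^ s * (lam ^ 2) ^ (-max s 0) *
        (Kerr.delta M a (Kerr.radius a x) ^ s * (Kerr.radius a x ^ 2 + a ^ 2) ^ (-max s 0)) := by
  rw [Kerr.radius_smul hlam, delta_dilate,
    show (lam * Kerr.radius a x) ^ 2 + (lam * a) ^ 2 = lam ^ 2 * (Kerr.radius a x ^ 2 + a ^ 2)
      by ring,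
    mul_zpow, mul_zpow]
  ring

/-- **The rescaled tensorised field at the dilated point**: for `α` on the dilated chart
`{r > λr₀}` of Kerr(`λM, λa`) and `y ∈ {r > r₀}`,
`(α̃ m_s ⊗ m_s)_{λM,λa}(λy) = K • ((α ∘ D_λ)~ m_s ⊗ m_s)_{M,a}(y)` with
`K = (λ²)^s (λ²)^{-max(s,0)} λ²` (every point, junk values included). [folklore] -/
private theorem tensorise_rescale_dilate (hlam : 0 < lam) (M a r₀ : ℝ) (s : ℤ)
    (α : Kerr.region (lam * a) (lam * r₀) → ℂ) (y : Kerr.region a r₀) :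
    Kerr.tensorise (lam * a) s (Kerr.rescale (lam * M) (lam * a) s α)
        ⟨lam • (y : E4), (Kerr.mem_region_dilate_iff hlam).2 y.2⟩ =
      ((lam ^ 2) ^ s * (lam ^ 2) ^ (-max s 0) * lam ^ 2 : ℝ) •
        Kerr.tensorise a s (Kerr.rescale M a s
          (fun z : Kerr.region a r₀ ↦ α ⟨lam • (z : E4), (Kerr.mem_region_dilate_iff hlam).2 z.2⟩))
          y := by
  funext μ ν
  simp only [Kerr.tensorise, Kerr.rescale, Pi.smul_apply, Complex.real_smul,
    rescaleFactor_dilate hlam, spinFrame_dilate hlam]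
  push_cast
  ring

/-! ### The dilation between the charts and the slab neighbourhoods -/

/-- **The dilation `D_λ : {r > r₀} → {r > λr₀}`, `y ↦ λy`, is smooth** (the restriction of the
linear map `λ • id` to the dilation covariant chart domains). [cite: KerrSchild1965, §2] -/
private theorem contMDiff_dilate (hlam : 0 < lam) (a r₀ : ℝ) :
    ContMDiff 𝓘(ℝ, E4) 𝓘(ℝ, E4) ∞
      (fun y : Kerr.region a r₀ ↦
        (⟨lam • (y : E4), (Kerr.mem_region_dilate_iff hlam).2 y.2⟩ :
          Kerr.region (lam * a) (lam * r₀))) :=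
  (ContMDiff.subtypeVal_comp_iff _ _).1
    ((lam • ContinuousLinearMap.id ℝ E4).contDiff.contMDiff.comp contMDiff_subtype_val)

/-- The dilation maps the slab neighbourhood `{τ₀/λ − θ' < t* < τ₁/λ + θ'}` into
`{τ₀ − ϑ < t* < τ₁ + ϑ}` as soon as `θ' ≤ ϑ/λ` (`λ > 0`). [folklore] -/
private theorem slab_dilate (hlam : 0 < lam) {τ₀ τ₁ θ' ϑ : ℝ} (hϑ : θ' ≤ ϑ / lam) {y : E4}
    (h₀ : τ₀ / lam - θ' < y 0) (h₁ : y 0 < τ₁ / lam + θ') :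
    τ₀ - ϑ < (lam • y) 0 ∧ (lam • y) 0 < τ₁ + ϑ := by
  rw [smul_coord]
  constructor
  · have h : (τ₀ - ϑ) / lam < y 0 := by
      rw [sub_div]
      linarith
    rw [div_lt_iff₀ hlam] at h
    linarith
  · have h : y 0 < (τ₁ + ϑ) / lam := by
      rw [add_div]
      linarith
    rw [lt_div_iff₀ hlam] at h
    linarith

/-- **Smoothness of the pulled-back witness**: if `T` is `C^∞` on `{τ₀ − θ < t* < τ₁ + θ}` of the
dilated chart, then `y ↦ K • T(λy)` is `C^∞` on `{τ₀/λ − θ' < t* < τ₁/λ + θ'}` of the original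
chart (`θ' ≤ θ/λ`). [cite: DafermosHolzegelRodnianskiTaylor2022, §1.1 (1.3)] -/
private theorem contMDiffOn_pullback (hlam : 0 < lam) {a r₀ τ₀ τ₁ θ θ' : ℝ} (hθ' : θ' ≤ θ / lam)
    {T : Kerr.region (lam * a) (lam * r₀) → Fin 4 → Fin 4 → ℂ}
    (hT : ContMDiffOn 𝓘(ℝ, E4) 𝓘(ℝ, Fin 4 → Fin 4 → ℂ) ∞ T
      {x | τ₀ - θ < (x : E4) 0 ∧ (x : E4) 0 < τ₁ + θ}) (K : ℝ) :
    ContMDiffOn 𝓘(ℝ, E4) 𝓘(ℝ, Fin 4 → Fin 4 → ℂ) ∞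
      (fun y : Kerr.region a r₀ ↦
        K • T ⟨lam • (y : E4), (Kerr.mem_region_dilate_iff hlam).2 y.2⟩)
      {x | τ₀ / lam - θ' < (x : E4) 0 ∧ (x : E4) 0 < τ₁ / lam + θ'} := by
  have hc : ContMDiffOn 𝓘(ℝ, E4) 𝓘(ℝ, ℝ) ∞ (fun _ : Kerr.region a r₀ ↦ K)
      {x | τ₀ / lam - θ' < (x : E4) 0 ∧ (x : E4) 0 < τ₁ / lam + θ'} := contMDiffOn_const
  exact hc.smul (hT.comp (contMDiff_dilate hlam a r₀).contMDiffOn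
    fun y hy ↦ slab_dilate hlam hθ' hy.1 hy.2)

/-- **Agreement of the pulled-back witness**: if `T` agrees with `α̃ m_s ⊗ m_s` on
`{τ₀ − θ < t* < τ₁ + θ}` of the dilated chart off the axis and off `{Δ = 0}`, then
`K⁻¹ • (T ∘ D_λ)` agrees with `(α ∘ D_λ)~ m_s ⊗ m_s` on `{τ₀/λ − θ' < t* < τ₁/λ + θ'}` of the
original chart off the axis and off `{Δ = 0}` (`θ' ≤ θ/λ`; the axis and `{Δ = 0}` are dilation
invariant). [cite: DafermosHolzegelRodnianskiTaylor2022, §1.1 (1.3)] -/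
private theorem pullback_agree (hlam : 0 < lam) {M a r₀ : ℝ} {s : ℤ} {τ₀ τ₁ θ θ' : ℝ}
    (hθ' : θ' ≤ θ / lam) {α : Kerr.region (lam * a) (lam * r₀) → ℂ}
    {T : Kerr.region (lam * a) (lam * r₀) → Fin 4 → Fin 4 → ℂ}
    (hTeq : ∀ x : Kerr.region (lam * a) (lam * r₀), τ₀ - θ < (x : E4) 0 → (x : E4) 0 < τ₁ + θ →
      (x : E4) ∉ Kerr.axis → Kerr.delta (lam * M) (lam * a) (Kerr.radius (lam * a) (x : E4)) ≠ 0 →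
      T x = Kerr.tensorise (lam * a) s (Kerr.rescale (lam * M) (lam * a) s α) x)
    (y : Kerr.region a r₀) (h₀ : τ₀ / lam - θ' < (y : E4) 0) (h₁ : (y : E4) 0 < τ₁ / lam + θ')
    (hax : (y : E4) ∉ Kerr.axis) (hΔ : Kerr.delta M a (Kerr.radius a (y : E4)) ≠ 0) :
    ((lam ^ 2) ^ s * (lam ^ 2) ^ (-max s 0) * lam ^ 2 : ℝ)⁻¹ •
        T ⟨lam • (y : E4), (Kerr.mem_region_dilate_iff hlam).2 y.2⟩ =
      Kerr.tensorise a s (Kerr.rescale M a s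
        (fun z : Kerr.region a r₀ ↦ α ⟨lam • (z : E4), (Kerr.mem_region_dilate_iff hlam).2 z.2⟩))
        y := by
  have h2 : lam ^ 2 ≠ 0 := pow_ne_zero 2 hlam.ne'
  have hK : ((lam ^ 2) ^ s * (lam ^ 2) ^ (-max s 0) * lam ^ 2 : ℝ) ≠ 0 :=
    mul_ne_zero (mul_ne_zero (zpow_ne_zero _ h2) (zpow_ne_zero _ h2)) h2
  obtain ⟨h₀', h₁'⟩ := slab_dilate hlam hθ' h₀ h₁
  have hax' : lam • (y : E4) ∉ Kerr.axis := fun h ↦ hax ((smul_mem_axis_iff hlam.ne' _).1 h)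
  have hΔ' : Kerr.delta (lam * M) (lam * a) (Kerr.radius (lam * a) (lam • (y : E4))) ≠ 0 := by
    rw [delta_radius_dilate hlam]
    exact mul_ne_zero h2 hΔ
  rw [hTeq ⟨lam • (y : E4), (Kerr.mem_region_dilate_iff hlam).2 y.2⟩ h₀' h₁' hax' hΔ',
    tensorise_rescale_dilate hlam, inv_smul_smul₀ hK]

/-! ### The stub -/

/-- **`D2` — sourced Teukolsky slab pairs pull back along the dilation** (stub
`stub_slabPair_dilate` of the line `bounded-kappa-closing-box` for the crux `BulkKerrCaptureC2`).
Assume `D1` (dilation covariance of the Teukolsky operator `Kerr.teukolskyOpOn` under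
`(M, a, r₀, x) ↦ (λM, λa, λr₀, λx)` for fields whose extension by zero is `C²` at `λx`) and `D0`
(the field of a sourced slab pair is `C^∞` on the open slab neighbourhood off the axis and off
`{Δ = 0}`). Then for `λ > 0` a sourced spin-`s` pair `(α, F)` on the slab `[τ₀, τ₁]` of the chart
`{r > λr₀}` of Kerr(`λM, λa`) pulls back under `D_λ : y ↦ λy` to the sourced pair
`(α ∘ D_λ, F ∘ D_λ)` on the slab `[τ₀/λ, τ₁/λ]` of the chart `{r > r₀}` of Kerr(`M, a`): the
witnesses are `K⁻¹ • (T ∘ D_λ)`, `K⁻¹ • (S ∘ D_λ)` with `K = (λ²)^s (λ²)^{-max(s,0)} λ²` on the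
neighbourhood of half-width `min θ θ₀ / λ` (`θ` the half-width of the pair, `θ₀` that of `D0`),
the equation is `D1` composed with the equation of the pair, its `C²` premise supplied by `D0`.
[cite: DafermosHolzegelRodnianskiTaylor2022, §1.1 (1.3)] -/
theorem stub_slabPair_dilate :
    (∀ [Kerr.Facts] (lam : ℝ) (hlam : 0 < lam) (M a r₀ : ℝ)
      [(Kerr.metric M a r₀).HasLeviCivita]
      [(Kerr.metric (lam * M) (lam * a) (lam * r₀)).HasLeviCivita]
      (s : ℤ) (α : Kerr.region (lam * a) (lam * r₀) → ℂ) (x : Kerr.region a r₀),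
      ContDiffAt ℝ 2 (Function.extend Subtype.val α (0 : E4 → ℂ)) (lam • (x : E4)) →
      Kerr.teukolskyOpOn M a r₀ s
          (fun y : Kerr.region a r₀ ↦ α ⟨lam • (y : E4), (Kerr.mem_region_dilate_iff hlam).2 y.2⟩)
          x =
        Kerr.teukolskyOpOn (lam * M) (lam * a) (lam * r₀) s α
          ⟨lam • (x : E4), (Kerr.mem_region_dilate_iff hlam).2 x.2⟩) →
    (∀ [Kerr.Facts] (M a r₀ : ℝ) [(Kerr.metric M a r₀).HasLeviCivita] (s : ℤ) (τ₀ τ₁ : ℝ)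
      (α F : Kerr.region a r₀ → ℂ), Kerr.IsTeukolskyPairOnSlab M a r₀ s τ₀ τ₁ α F →
      ∃ θ : ℝ, 0 < θ ∧ ∀ x : Kerr.region a r₀, τ₀ - θ < (x : E4) 0 → (x : E4) 0 < τ₁ + θ →
        (x : E4) ∉ Kerr.axis → Kerr.delta M a (Kerr.radius a (x : E4)) ≠ 0 →
        ContDiffAt ℝ ((⊤ : ℕ∞) : WithTop ℕ∞) (Function.extend Subtype.val α (0 : E4 → ℂ))
          (x : E4)) →
    ∀ [Kerr.Facts] (lam : ℝ) (hlam : 0 < lam) (M a r₀ : ℝ)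
      [(Kerr.metric M a r₀).HasLeviCivita]
      [(Kerr.metric (lam * M) (lam * a) (lam * r₀)).HasLeviCivita]
      (s : ℤ) (τ₀ τ₁ : ℝ) (α F : Kerr.region (lam * a) (lam * r₀) → ℂ),
      Kerr.IsTeukolskyPairOnSlab (lam * M) (lam * a) (lam * r₀) s τ₀ τ₁ α F →
      Kerr.IsTeukolskyPairOnSlab M a r₀ s (τ₀ / lam) (τ₁ / lam)
        (fun y : Kerr.region a r₀ ↦ α ⟨lam • (y : E4), (Kerr.mem_region_dilate_iff hlam).2 y.2⟩)
        (fun y : Kerr.region a r₀ ↦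
          F ⟨lam • (y : E4), (Kerr.mem_region_dilate_iff hlam).2 y.2⟩) := by
  intro hOp hSmooth _ lam hlam M a r₀ _ _ s τ₀ τ₁ α F hpair
  -- `D0` on the ORIGINAL pair: `α` is `C^∞` off the axis and off `{Δ = 0}` near the slab
  obtain ⟨θ₀, hθ₀, hC⟩ := hSmooth (lam * M) (lam * a) (lam * r₀) s τ₀ τ₁ α F hpair
  obtain ⟨θ, hθ, ⟨T, hT, hTeq⟩, ⟨S, hS, hSeq⟩, hEq⟩ := hpair
  -- the half-width of the pulled-back neighbourhood
  have hθ'pos : 0 < min θ θ₀ / lam := div_pos (lt_min hθ hθ₀) hlam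
  have hθ'θ : min θ θ₀ / lam ≤ θ / lam := div_le_div_of_nonneg_right (min_le_left _ _) hlam.le
  have hθ'θ₀ : min θ θ₀ / lam ≤ θ₀ / lam :=
    div_le_div_of_nonneg_right (min_le_right _ _) hlam.le
  have h2 : lam ^ 2 ≠ 0 := pow_ne_zero 2 hlam.ne'
  refine ⟨min θ θ₀ / lam, hθ'pos,
    ⟨fun y ↦ ((lam ^ 2) ^ s * (lam ^ 2) ^ (-max s 0) * lam ^ 2 : ℝ)⁻¹ •
        T ⟨lam • (y : E4), (Kerr.mem_region_dilate_iff hlam).2 y.2⟩,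
      contMDiffOn_pullback hlam hθ'θ hT _,
      fun y h₀ h₁ hax hΔ ↦ pullback_agree hlam hθ'θ hTeq y h₀ h₁ hax hΔ⟩,
    ⟨fun y ↦ ((lam ^ 2) ^ s * (lam ^ 2) ^ (-max s 0) * lam ^ 2 : ℝ)⁻¹ •
        S ⟨lam • (y : E4), (Kerr.mem_region_dilate_iff hlam).2 y.2⟩,
      contMDiffOn_pullback hlam hθ'θ hS _,
      fun y h₀ h₁ hax hΔ ↦ pullback_agree hlam hθ'θ hSeq y h₀ h₁ hax hΔ⟩,
    fun y h₀ h₁ hax hΔ ↦ ?_⟩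
  -- the equation: `D1` at `y`, then the equation of the pair at `λy`
  obtain ⟨h₀', h₁'⟩ := slab_dilate hlam hθ'θ h₀ h₁
  obtain ⟨h₀'', h₁''⟩ := slab_dilate hlam hθ'θ₀ h₀ h₁
  have hax' : lam • (y : E4) ∉ Kerr.axis := fun h ↦ hax ((smul_mem_axis_iff hlam.ne' _).1 h)
  have hΔ' : Kerr.delta (lam * M) (lam * a) (Kerr.radius (lam * a) (lam • (y : E4))) ≠ 0 := by
    rw [delta_radius_dilate hlam]
    exact mul_ne_zero h2 hΔ
  have hC2 : ContDiffAt ℝ 2 (Function.extend Subtype.val α (0 : E4 → ℂ)) (lam • (y : E4)) :=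
    (hC ⟨lam • (y : E4), (Kerr.mem_region_dilate_iff hlam).2 y.2⟩ h₀'' h₁'' hax' hΔ').of_le
      (WithTop.coe_le_coe.mpr le_top)
  rw [hOp lam hlam M a r₀ s α y hC2]
  exact hEq ⟨lam • (y : E4), (Kerr.mem_region_dilate_iff hlam).2 y.2⟩ h₀' h₁' hax' hΔ'

end Summit.FinalStateConjecture.FinalStateConjecture.Theorems.BulkKerrCaptureC2.SlabPairDilate

end
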